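import Summits.BirchSwinnertonDyer.BirchSwinnertonDyer.Theorems.ClassRecordThreeEulerHalvesAtThreeCartanSupplyCharacterSums
import Summits.BirchSwinnertonDyer.BirchSwinnertonDyer.Theorems.ClassRecordThreeEulerHalvesAtThreeCartanSupplyVirtualCharacterSums
import HarnessLib

/-!
# SUPPLY from PERMUTATION MODELS, X — the GL₂ packaging: SUPPLY from «`χ_W` is a virtual character of norm one»

Helper file riding `--supports stmt-BirchSwinnertonDyer-19109` (crux `EulerHalvesAtThree`; UNREGISTERED sub-line `Cruxes/EulerHalvesAtThree/Lines/cartan_corr`,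
seat `bsd-idea-10` g13), road C1 of the LINE OWNER's memo `HOME/tam3-p1/g23/SUPPLY-ROAD-GG1.md` §3. Files IX (`…VirtualCharacter`, `…VirtualCharacterSums`)
proved the GENERIC ENGINE over any field of characteristic zero: a virtual character `f = χ_A − χ_B` with `Σ_g f(g)f(g⁻¹) = |G|` and `dim B < dim A`
is the character of an irreducible `U` with `End_G(U) = k`, and then (α) `f(1)·Σ_h f(h⁻¹)f(hx) = |G|·f(x)` and (β) `f(1)·Σ_h f(h⁻¹)χ_V(gh) = |G|·f(g)`
for every `V` with `Σ_h f(h⁻¹)χ_V(h) = |G|`. THIS FILE packages it for `G = GL₂(𝔽_q)`, `f = χ_W = cubicNewvectorChar q`, `V = k[G ∕ T]`: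
* §1 `char_inv`: `χ_W(g⁻¹) = χ_W(g)` (from the matrix formula: `IsScalarMat`, `HasRatEigenvalue`, `Δ = 0`, the power tests are inverse-invariant);
* §2 `permRep k σ` — a permutation representation over a field and its character `#Fix` (LEAD's `TraceTools.trace_funLeft_perm_symm`);
* §3 `sum_char_mul_fixed_eq_card`: `Σ_h χ(h)·#Fix(h | G∕T) = |G|` for a class function with `Σ_{t ∈ T} χ(t) = |T|` (`card_conj_mem_eq_mul_fixed`);
* §4 `convolutionAt_of_virtual`: per prime `q ∉ {2,3}`, representations `A, B` over a field `k ⊇ ℚ` with `χ_W = χ_A − χ_B` and `Σ_g χ_W(g)² = |G|` give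
  the three conjuncts of `CartanConvolutionSupply` at `q` (torus sums `sum_char_splitTorusSub`, `sum_char_centralizerSub`, `exists_not_hasRatEigenvalue`);
* §5 NET, typed `@[conjecture]` nodes `CubicNewvectorCharNormOne` (`Σ_g χ_W(g)² = |GL₂(𝔽_q)|`, a class-by-class count) and `CubicNewvectorCharVirtual`
  (`χ_W = χ_A − χ_B` for two honest `ℚ`-representations — the LINE OWNER's `Y_s ∕ GG₁ ∕ Y_ns` of SUPPLY-ROAD-GG1 §1), and BY NAME
  `cartanConvolutionSupply_of_virtual`, `cartanTorusLatticeSupply_of_virtual : … → CartanTorusLatticeSupply` (the v11 stub SUPPLY of 23422's line `cartan`).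
HONEST FRAMING: the two nodes are NOT proved here; nothing about NUM, crux 23422 ∕ 19109 or any summit statement is proved by this seat; BSD is proved
for no curve. [folklore; cite: SerreLinearRepresentations1977 §2.3, §2.6]
-/

set_option linter.dupNamespace false
set_option autoImplicit false

noncomputable section

namespace Summit.BirchSwinnertonDyer.BirchSwinnertonDyer.Theorems.CartanSupply

open Module
open Summit.BirchSwinnertonDyer.BirchSwinnertonDyer.Theorems.CartanDegree
open Summit.BirchSwinnertonDyer.BirchSwinnertonDyer.Theorems.CartanTorusCubeCut
open Summit.BirchSwinnertonDyer.BirchSwinnertonDyer.Theorems.CartanCorrespondence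
open Summit.BirchSwinnertonDyer.BirchSwinnertonDyer.Theorems.CartanSupply.VirtualCharacter
open scoped Classical

universe u v w

/-! ## §1 `χ_W(g⁻¹) = χ_W(g)` -/

section inverse
variable {q : ℕ} [Fact q.Prime]

/-- PROVED: the inverse of a scalar element is scalar. [folklore] -/
theorem isScalarMat_coe_inv_of (g : G q) (h : IsScalarMat (g : Mat q)) : IsScalarMat ((g⁻¹ : G q) : Mat q) := by
  rw [PS.isScalarMat_iff_eq_smul_one] at h ⊢
  obtain ⟨c, hc⟩ := h
  have h1 : ((g⁻¹ : G q) : Mat q) * (g : Mat q) = 1 := by rw [← Units.val_mul, inv_mul_cancel, Units.val_one]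
  rw [hc, Matrix.mul_smul, mul_one] at h1
  have hc0 : c ≠ 0 := by
    rintro rfl
    rw [zero_smul] at h1
    exact zero_ne_one h1
  refine ⟨c⁻¹, ?_⟩
  rw [← h1, smul_smul, inv_mul_cancel₀ hc0, one_smul]

/-- PROVED: `g⁻¹` is scalar iff `g` is. [folklore] -/
theorem isScalarMat_coe_inv_iff (g : G q) : IsScalarMat ((g⁻¹ : G q) : Mat q) ↔ IsScalarMat (g : Mat q) :=
  ⟨fun h => by have := isScalarMat_coe_inv_of g⁻¹ h; rwa [inv_inv] at this, isScalarMat_coe_inv_of g⟩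

/-- PROVED: `det g⁻¹ = (det g)⁻¹`. [folklore] -/
theorem det_coe_inv (g : G q) : ((g⁻¹ : G q) : Mat q).det = ((g : Mat q).det)⁻¹ := by
  rw [Matrix.coe_units_inv, Matrix.det_nonsing_inv, Ring.inverse_eq_inv]

/-- PROVED: `tr g⁻¹ = (det g)⁻¹ · tr g` (`2 × 2`). [folklore] -/
theorem trace_coe_inv (g : G q) : ((g⁻¹ : G q) : Mat q).trace = ((g : Mat q).det)⁻¹ * (g : Mat q).trace := by
  rw [Matrix.coe_units_inv, Matrix.inv_def, Ring.inverse_eq_inv, Matrix.trace_smul, Matrix.adjugate_fin_two, Matrix.trace_fin_two_of,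
    Matrix.trace_fin_two, smul_eq_mul, add_comm ((g : Mat q) 1 1)]

/-- PROVED: `g⁻¹` has a rational eigenvalue iff `g` has (`λ ↦ tr g − det g · λ⁻¹… `: if `x` is a root for `g⁻¹` then `tr g − det g·x` is one for `g`). [folklore] -/
theorem hasRatEigenvalue_coe_inv_iff (g : G q) : HasRatEigenvalue ((g⁻¹ : G q) : Mat q) ↔ HasRatEigenvalue (g : Mat q) := by
  unfold HasRatEigenvalue
  rw [det_coe_inv, trace_coe_inv]
  set d := (g : Mat q).det with hd
  set t := (g : Mat q).trace with ht
  have hd0 : d ≠ 0 := (Matrix.isUnits_det_units g).ne_zero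
  have hdinv : d * d⁻¹ = 1 := mul_inv_cancel₀ hd0
  constructor
  · rintro ⟨x, hx⟩
    exact ⟨t - d * x, by linear_combination (d * d) * hx + (t * d * x - d) * hdinv⟩
  · rintro ⟨y, hy⟩
    exact ⟨d⁻¹ * t - d⁻¹ * y, by linear_combination (d⁻¹ * d⁻¹) * hy + (-d⁻¹) * hdinv⟩

/-- PROVED: `Δ(g⁻¹) = (det g)⁻² Δ(g)`, so `Δ(g⁻¹) = 0 ↔ Δ(g) = 0`. [folklore] -/
theorem discr_coe_inv_eq_zero_iff (g : G q) :
    ((g⁻¹ : G q) : Mat q).trace ^ 2 - 4 * ((g⁻¹ : G q) : Mat q).det = 0 ↔ (g : Mat q).trace ^ 2 - 4 * (g : Mat q).det = 0 := by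
  rw [det_coe_inv, trace_coe_inv]
  set d := (g : Mat q).det with hd
  set t := (g : Mat q).trace with ht
  have hd0 : d ≠ 0 := (Matrix.isUnits_det_units g).ne_zero
  have hdinv : d * d⁻¹ = 1 := mul_inv_cancel₀ hd0
  have key : (d⁻¹ * t) ^ 2 - 4 * d⁻¹ = d⁻¹ ^ 2 * (t ^ 2 - 4 * d) := by linear_combination (4 * d⁻¹) * hdinv
  rw [key, mul_eq_zero, or_iff_right (pow_ne_zero 2 (inv_ne_zero hd0))]

/-- PROVED: a power of `g⁻¹` is scalar iff the same power of `g` is. [folklore] -/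
theorem isScalarMat_coe_inv_pow_iff (g : G q) (e : ℕ) : IsScalarMat (((g⁻¹ : G q) : Mat q) ^ e) ↔ IsScalarMat ((g : Mat q) ^ e) := by
  rw [← Units.val_pow_eq_pow_val, ← Units.val_pow_eq_pow_val, inv_pow, isScalarMat_coe_inv_iff]

/-- PROVED: `(g⁻¹)^e = 1 ↔ g^e = 1` on matrices. [folklore] -/
theorem coe_inv_pow_eq_one_iff (g : G q) (e : ℕ) : ((g⁻¹ : G q) : Mat q) ^ e = 1 ↔ (g : Mat q) ^ e = 1 := by
  rw [← Units.val_pow_eq_pow_val, ← Units.val_pow_eq_pow_val, inv_pow, Units.val_eq_one, inv_eq_one, ← Units.val_eq_one]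

/-- PROVED — **`χ_W(g⁻¹) = χ_W(g)`** (`χ_W` is real: every test in `cubicNewvectorCharMat` is inverse-invariant). [folklore] -/
theorem char_inv (g : G q) : cubicNewvectorChar q g⁻¹ = cubicNewvectorChar q g := by
  have h1 := discr_coe_inv_eq_zero_iff g
  have h2 := isScalarMat_coe_inv_iff g
  have h3 := hasRatEigenvalue_coe_inv_iff g
  have h4 := isScalarMat_coe_inv_pow_iff g ((q - 1) / 3)
  have h5 := coe_inv_pow_eq_one_iff g ((q ^ 2 - 1) / 3)
  simp only [cubicNewvectorChar, cubicNewvectorCharMat, h1, h2, h3, h4, h5]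

omit [Fact q.Prime] in
/-- PROVED: `χ_W(ab) = χ_W(ba)`. [folklore] -/
theorem char_mul_comm (a b : G q) : cubicNewvectorChar q (a * b) = cubicNewvectorChar q (b * a) := by
  have := PS.char_conj a (b * a)
  rwa [← mul_assoc, mul_inv_cancel_right] at this

/-- PROVED: `χ_W(1) = q + 1` resp. `q − 1`; in particular `0 < χ_W(1)`. [folklore] -/
theorem char_one_pos : 0 < cubicNewvectorChar q 1 := by
  have hq : 2 ≤ q := (Fact.out : q.Prime).two_le
  unfold cubicNewvectorChar
  rw [Units.val_one, PS.charMat_of_isScalar PS.isScalarMat_one]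
  have h2 : (2 : ℤ) ≤ (q : ℤ) := by exact_mod_cast hq
  split_ifs <;> omega

end inverse

/-! ## §2 Permutation representations over a field -/

section permRep
variable (k : Type w) [Field k] {Γ : Type v} [Group Γ] {n : ℕ} (σ : Γ →* Equiv.Perm (Fin n))

/-- The permutation representation `k[Fin n]` of `σ : Γ → Sym(Fin n)`: `(g·φ)(i) = φ((σ g)⁻¹ i)`. -/
def permRep : Representation k Γ (Fin n → k) where
  toFun g := LinearMap.funLeft k k ⇑(σ g)⁻¹
  map_one' := by
    apply LinearMap.ext; intro φ; funext i
    simp only [map_one, inv_one, Equiv.Perm.coe_one, LinearMap.funLeft_apply, id_eq, Module.End.one_apply]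
  map_mul' := by
    intro g h; apply LinearMap.ext; intro φ; funext i
    simp only [map_mul, mul_inv_rev, Equiv.Perm.coe_mul, LinearMap.funLeft_apply, Function.comp_apply, Module.End.mul_apply]

/-- PROVED: the character of a permutation representation counts fixed points. [folklore] -/
theorem permRep_character (g : Γ) :
    (permRep k σ).character g = ((Finset.univ.filter fun i : Fin n => σ g i = i).card : k) := by
  show LinearMap.trace k _ (LinearMap.funLeft k k ⇑(σ g)⁻¹) = _
  rw [Equiv.Perm.inv_def]
  exact TraceTools.trace_funLeft_perm_symm (σ g)

end permRep

/-! ## §3 `⟨χ, Ind_T^G 1⟩ = 1` as a finite sum -/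

section fixedSum
variable {Γ : Type v} [Group Γ] [Fintype Γ] (T : Subgroup Γ)

/-- PROVED: for a class function `χ` with `Σ_{t ∈ T} χ(t) = |T|`: `Σ_h χ(h)·#Fix(h | Γ∕T) = |Γ|` (double counting `y⁻¹hy ∈ T`). [folklore] -/
theorem sum_char_mul_fixed_eq_card (χ : Γ → ℤ) (hcl : ∀ a b, χ (a * b) = χ (b * a)) (hT : ∑ t : T, χ t = Nat.card T) :
    ∑ h, χ h * ((Finset.univ.filter fun i : Fin (Nat.card (Γ ⧸ T)) => cosetPerm T h i = i).card : ℤ) = Fintype.card Γ := by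
  have hTne : (Nat.card T : ℤ) ≠ 0 := by exact_mod_cast (Nat.card_pos (α := T)).ne'
  apply mul_left_cancel₀ hTne
  have h1 : (Nat.card T : ℤ) * ∑ h, χ h * ((Finset.univ.filter fun i : Fin (Nat.card (Γ ⧸ T)) => cosetPerm T h i = i).card : ℤ) =
      ∑ h, χ h * ((Finset.univ.filter fun y : Γ => y⁻¹ * h * y ∈ T).card : ℤ) := by
    rw [Finset.mul_sum]
    refine Finset.sum_congr rfl (fun h _ => ?_)
    rw [card_conj_mem_eq_mul_fixed T h]
    push_cast
    ring
  have h2 : ∑ h, χ h * ((Finset.univ.filter fun y : Γ => y⁻¹ * h * y ∈ T).card : ℤ) = ∑ y : Γ, ∑ h : Γ, (if y⁻¹ * h * y ∈ T then χ h else 0) := by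
    rw [Finset.sum_comm]
    refine Finset.sum_congr rfl (fun h _ => ?_)
    simp only [Finset.card_filter, Nat.cast_sum, Nat.cast_ite, Nat.cast_one, Nat.cast_zero, Finset.mul_sum, mul_boole]
  have h3 : ∀ y : Γ, ∑ h : Γ, (if y⁻¹ * h * y ∈ T then χ h else 0) = ∑ x : Γ, (if x ∈ T then χ x else 0) := fun y => by
    refine Fintype.sum_equiv ((Equiv.mulLeft y⁻¹).trans (Equiv.mulRight y)) _ _ (fun h => ?_)
    simp only [Equiv.trans_apply, Equiv.coe_mulLeft, Equiv.coe_mulRight]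
    have hc : χ (y⁻¹ * h * y) = χ h := by rw [hcl, ← mul_assoc, mul_inv_cancel, one_mul]
    rw [hc]
  have h4 : ∑ x : Γ, (if x ∈ T then χ x else 0) = Nat.card T := by
    rw [← Finset.sum_filter, Finset.sum_subtype (Finset.univ.filter fun x : Γ => x ∈ T) (p := fun x => x ∈ T) (fun x => by simp)]
    exact hT
  rw [h1, h2]
  simp only [h3, h4, Finset.sum_const, Finset.card_univ]
  ring

end fixedSum

/-! ## §4 The engine at one prime: (α), (β) for `χ_W` from «virtual of norm one» -/

section engine
variable {q : ℕ} [Fact q.Prime]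

/-- PROVED — **CONVOLUTION SUPPLY AT `q` FROM A VIRTUAL REALISATION OF NORM ONE**: if `χ_W = χ_A − χ_B` for representations `A, B` of `GL₂(𝔽_q)` over a
field of characteristic zero and `Σ_g χ_W(g)² = |GL₂(𝔽_q)|`, then (α) and (β) of `CartanConvolutionSupply` hold at `q` (`q ∉ {2, 3}`).
[folklore; cite: SerreLinearRepresentations1977 §2.3, §2.6] -/
theorem convolutionAt_of_virtual (hq2 : q ≠ 2) (h3 : q ≠ 3) {k : Type w} [Field k] [CharZero k]
    {VA : Type u} {VB : Type v} [AddCommGroup VA] [Module k VA] [FiniteDimensional k VA] [AddCommGroup VB] [Module k VB] [FiniteDimensional k VB]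
    (ρA : Representation k (G q) VA) (ρB : Representation k (G q) VB)
    (hAB : ∀ g, (cubicNewvectorChar q g : k) = ρA.character g - ρB.character g)
    (hnorm : ∑ g : G q, cubicNewvectorChar q g ^ 2 = Fintype.card (G q)) :
    (∀ x : G q, cubicNewvectorChar q 1 * ∑ h : G q, cubicNewvectorChar q h * cubicNewvectorChar q (h⁻¹ * x) =
        Fintype.card (G q) * cubicNewvectorChar q x) ∧
    (q % 3 = 1 → ∀ g : G q, cubicNewvectorChar q 1 * ∑ h : G q, cubicNewvectorChar q h *
        ((Finset.univ.filter fun i : Fin (Nat.card (G q ⧸ splitTorusSub q)) => cosetPerm (splitTorusSub q) (g * h) i = i).card : ℤ) =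
        Fintype.card (G q) * cubicNewvectorChar q g) ∧
    (q % 3 = 2 → ∃ η : Mat q, ¬ HasRatEigenvalue η ∧ ∀ g : G q, cubicNewvectorChar q 1 * ∑ h : G q, cubicNewvectorChar q h *
        ((Finset.univ.filter fun i : Fin (Nat.card (G q ⧸ centralizerSub η)) => cosetPerm (centralizerSub η) (g * h) i = i).card : ℤ) =
        Fintype.card (G q) * cubicNewvectorChar q g) := by
  set f : G q → k := fun g => (cubicNewvectorChar q g : k) with hfdef
  have hf : ∀ g, f g = ρA.character g - ρB.character g := hAB
  have hfinv : ∀ g, f g⁻¹ = f g := fun g => by simp only [hfdef, char_inv]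
  -- norm one in the engine's form
  have hnormk : ∑ g, f g * f g⁻¹ = Fintype.card (G q) := by
    have := congrArg (fun z : ℤ => (z : k)) hnorm
    push_cast at this
    rw [← this]
    exact Finset.sum_congr rfl (fun g _ => by rw [hfinv, sq])
  -- dimensions
  have hdim : finrank k VB < finrank k VA := by
    have h1 := hf 1
    rw [Representation.char_one, Representation.char_one, hfdef] at h1
    have h1' : ((cubicNewvectorChar q 1 : ℤ) : k) = ((finrank k VA : ℤ) - (finrank k VB : ℤ) : ℤ) := by push_cast; exact h1
    have h2 := Int.cast_injective (α := k) h1'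
    have h3 := char_one_pos (q := q)
    omega
  -- the engine
  obtain ⟨U, _, _, _, ρU, hirr, hE, hχU⟩ := exists_irreducible_of_virtual_normOne ρA ρB f hf hnormk hdim
  haveI := hirr
  have hnormU : ∑ g, ρU.character g * ρU.character g⁻¹ = Fintype.card (G q) := by simp only [hχU]; exact hnormk
  refine ⟨fun x => ?_, fun h1 g => ?_, fun h2 => ?_⟩
  · -- (α)
    have hα := alpha_sum ρU hE hnormU x
    simp only [hχU] at hα
    apply Int.cast_injective (α := k)
    push_cast
    rw [← hα]
    congr 1
    exact Fintype.sum_equiv (Equiv.inv (G q)) _ _ (fun h => by simp only [Equiv.inv_apply, inv_inv, hfdef])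
  · -- (β), split torus
    have hm : ∑ h, f h⁻¹ * (permRep k (cosetPerm (splitTorusSub q))).character h = Fintype.card (G q) := by
      have hs := sum_char_mul_fixed_eq_card (splitTorusSub q) (cubicNewvectorChar q) char_mul_comm sum_char_splitTorusSub
      have := congrArg (fun z : ℤ => (z : k)) hs
      push_cast at this
      rw [← this]
      exact Finset.sum_congr rfl (fun h _ => by rw [hfinv, permRep_character])
    have hβ := beta_sum ρU hE hnormU (permRep k (cosetPerm (splitTorusSub q))) (by simp only [hχU]; exact hm) g
    simp only [hχU, permRep_character] at hβ
    apply Int.cast_injective (α := k)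
    push_cast
    rw [← hβ]
    congr 1
    exact Finset.sum_congr rfl (fun h _ => by rw [hfinv])
  · -- (β), non-split torus
    obtain ⟨η, hη⟩ := exists_not_hasRatEigenvalue hq2
    refine ⟨η, hη, fun g => ?_⟩
    have hm : ∑ h, f h⁻¹ * (permRep k (cosetPerm (centralizerSub η))).character h = Fintype.card (G q) := by
      have hs := sum_char_mul_fixed_eq_card (centralizerSub η) (cubicNewvectorChar q) char_mul_comm (sum_char_centralizerSub hq2 h3 hη)
      have := congrArg (fun z : ℤ => (z : k)) hs
      push_cast at this
      rw [← this]
      exact Finset.sum_congr rfl (fun h _ => by rw [hfinv, permRep_character])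
    have hβ := beta_sum ρU hE hnormU (permRep k (cosetPerm (centralizerSub η))) (by simp only [hχU]; exact hm) g
    simp only [hχU, permRep_character] at hβ
    apply Int.cast_injective (α := k)
    push_cast
    rw [← hβ]
    congr 1
    exact Finset.sum_congr rfl (fun h _ => by rw [hfinv])

end engine

/-! ## §5 NET: two typed nodes and SUPPLY by name -/

/-- **NORM ONE**: `Σ_{g ∈ GL₂(𝔽_q)} χ_W(g)² = |GL₂(𝔽_q)|` for every prime `q ∉ {2, 3}` — a class-by-class count with the values of `cubicNewvectorCharMat`
(`(q+1)²(q−1) + (q−1)(q²−1) + q(q+1)·[4·(q−1)(q−4)∕6 + (q−1)²∕3]·… = q(q−1)²(q+1)` etc.). NOT proved here. [folklore] -/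
@[conjecture]
def CubicNewvectorCharNormOne : Prop := ∀ q : ℕ, ∀ _hq : Fact q.Prime, q ≠ 3 → q ≠ 2 →
  ∑ g : G q, cubicNewvectorChar q g ^ 2 = Fintype.card (G q)

/-- **VIRTUAL REALISATION**: for every prime `q ∉ {2, 3}` there are two finite-dimensional `ℚ`-representations `A, B` of `GL₂(𝔽_q)` with
`χ_W = χ_A − χ_B` (the LINE OWNER's permutation ∕ Gelfand–Graev lattices: `Y_s, GG₁` at `q ≡ 1 (3)`, `GG₁, Y_ns` at `q ≡ 2 (3)`). NOT proved here. [folklore] -/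
@[conjecture]
def CubicNewvectorCharVirtual : Prop := ∀ q : ℕ, ∀ _hq : Fact q.Prime, q ≠ 3 → q ≠ 2 →
  ∃ (VA : Type) (_ : AddCommGroup VA) (_ : Module ℚ VA) (_ : FiniteDimensional ℚ VA)
    (VB : Type) (_ : AddCommGroup VB) (_ : Module ℚ VB) (_ : FiniteDimensional ℚ VB)
    (ρA : Representation ℚ (G q) VA) (ρB : Representation ℚ (G q) VB),
    ∀ g : G q, (cubicNewvectorChar q g : ℚ) = ρA.character g - ρB.character g

/-- PROVED — **CONVOLUTION SUPPLY ⟸ NORM ONE + VIRTUAL REALISATION**. [folklore] -/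
theorem cartanConvolutionSupply_of_virtual (hN : CubicNewvectorCharNormOne) (hV : CubicNewvectorCharVirtual) : CartanConvolutionSupply := by
  intro q hq h3 hq2
  obtain ⟨VA, _, _, _, VB, _, _, _, ρA, ρB, hAB⟩ := hV q hq h3 hq2
  exact convolutionAt_of_virtual hq2 h3 ρA ρB hAB (hN q hq h3 hq2)

/-- PROVED — **SUPPLY ⟸ NORM ONE + VIRTUAL REALISATION** (`CartanTorusLatticeSupply`, the v11 stub of 23422's line `cartan`, BY NAME). [folklore] -/
theorem cartanTorusLatticeSupply_of_virtual (hN : CubicNewvectorCharNormOne) (hV : CubicNewvectorCharVirtual) : CartanTorusLatticeSupply :=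
  cartanTorusLatticeSupply_of_convolutionSupply (cartanConvolutionSupply_of_virtual hN hV)

end Summit.BirchSwinnertonDyer.BirchSwinnertonDyer.Theorems.CartanSupply

end
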